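import Mathlib
import Summits.AtomisticToContinuum.HydrodynamicLimit.Theorems.ImplosionDichotomyDenseExcursionPackingResolventInnerAlgebraB

/-!
# The inner region of the packing-resolvent gain, pointwise: atoms, the `V`-source envelope and the normal form
# with its coefficient bounds at every `x ≤ x_Λ`
# (crux `DenseExcursion`, stmt-AtomisticToContinuum-12586, line `sonic-cavity-renewal` v8, stub `stub_packingResolventW`)

Helper file (`--supports stmt-AtomisticToContinuum-12586`) for the registered stub `stub_packingResolventW` (skeleton v8;
registered helper here: `packingResolventW_innerPoint`). It turns the landed one-point algebra/arithmetic of the inner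
region (`inner_normal_form`, `packingResolventW_innerCoeff`, `inner_h1_bound`, `inner_h2_bound`) into statements about
the profile FUNCTIONS `W, S` and a differentiable real solution `(u₁, u₂)` of the real resolvent system at a point
`x ≤ x_Λ`, `e^{x_Λ} = 2s₀/Λ`, from the digested cavity-tube data (`htc`: envelope (c) on `x ≤ 1`; `htd`: centre expansion
(d) on `x ≤ 0`):

* `inner_atoms_at`: `eˣ ≤ 2/Λ`, the four second-order atoms `≤ 1/Λ²`, `7/10 ≤ eˣS ≤ 1`, positivity of the reduced
  determinant `S² − (1 − W)²`, and `ρ = Λeˣ/s₀ ∈ (0, 2]`;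
* `inner_h2_at`: the `V`-source `h₂ = −Λe^{2x}S((1 − W)f₂ + Sf₁/3)/(s₀²(S² − (1−W)²))` of a `(1 + S)`-weighted source of
  size `N` obeys `|h₂| ≤ N(17ρ/50 + ρ²/100)` (the envelope integrated by `packingResolventW_innerPrimitive`);
* `packingResolventW_innerPoint`: the normal form `u₁′ = a₁₁u₁ + a₁₂V + h₁`, `V′ = a₂₁u₁ + a₂₂V + h₂` of
  `V = Λe^{2x}Su₂/s₀²` holds at `x` with SOME coefficients satisfying `|a₁₁ + 3| ≤ 8/Λ`, `|a₁₂ − 3| ≤ 1/(10Λ)`,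
  `|a₂₁ − ρ²/3| ≤ (2/3)ρ²/Λ`, `0 ≤ a₂₂ ≤ (9/10)ρ²/Λ`, `|h₁| ≤ 3.01N`, and `V` has the displayed derivative.
-/

noncomputable section

open Set

namespace Summit.AtomisticToContinuum.HydrodynamicLimit.Theorems.PackingAnalyticImplosion

section Inner

variable {r Λ δ s₀ N xL : ℝ} {W S u₁ u₂ f₁ f₂ : ℝ → ℝ}

/-- **THE ATOMS AT A POINT OF THE INNER REGION.** For `x ≤ x_Λ` (`e^{x_Λ} = 2s₀/Λ`, `Λ ≥ 1000`, `δ = 1/Λ`): `0 < eˣ ≤ 2δ`,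
`eˣΛ ≤ 2s₀`, `x ≤ 0`, `7/10 ≤ eˣS ≤ 1`, the four centre atoms `|eˣS − s₀|, |eˣ(S + S′)|, |W − (r−1)|, |W′| ≤ δ²`, the reduced
determinant `S² − (1 − W)² > 0`, and `ρ = (Λ/s₀)eˣ ∈ (0, 2]` with `ρs₀ = Λeˣ`. [folklore] -/
theorem inner_atoms_at (hδΛ : δ * Λ = 1) (hδ : 0 < δ) (hδ' : δ ≤ 1 / 1000) (hs₀ : 7 / 10 ≤ s₀) (hs₀' : s₀ ≤ 1)
    (hxL : Real.exp xL = 2 * s₀ / Λ)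
    (htc : ∀ x, x ≤ 1 → |W x| ≤ 1 / 4 ∧ 7 / 10 ≤ Real.exp x * S x ∧ Real.exp x * S x ≤ 1)
    (htd : ∀ x, x ≤ 0 → |W x - (r - 1)| ≤ Real.exp x ^ 2 / 10 + 2 * Real.exp x ^ 4 ∧
      |deriv W x| ≤ Real.exp x ^ 2 / 5 + 2 * Real.exp x ^ 4 ∧ |Real.exp x * S x - s₀| ≤ Real.exp x ^ 2 / 10 + 2 * Real.exp x ^ 4 ∧
      |Real.exp x * (S x + deriv S x)| ≤ Real.exp x ^ 2 / 5 + 2 * Real.exp x ^ 4)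
    {x : ℝ} (hx : x ≤ xL) :
    0 < Real.exp x ∧ Real.exp x ≤ 2 * δ ∧ Real.exp x * Λ ≤ 2 * s₀ ∧ x ≤ 0 ∧
      7 / 10 ≤ S x * Real.exp x ∧ S x * Real.exp x ≤ 1 ∧ |S x * Real.exp x - s₀| ≤ δ ^ 2 ∧
      |Real.exp x * (S x + deriv S x)| ≤ δ ^ 2 ∧ |W x - (r - 1)| ≤ δ ^ 2 ∧ |deriv W x| ≤ δ ^ 2 ∧
      0 < S x ^ 2 - (1 - W x) ^ 2 ∧ (Λ / s₀ * Real.exp x) * s₀ = Λ * Real.exp x ∧ 0 < Λ / s₀ * Real.exp x ∧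
      Λ / s₀ * Real.exp x ≤ 2 := by
  have hΛ : 1000 ≤ Λ := thousand_le_of_delta hδΛ hδ hδ'
  have hΛpos : 0 < Λ := by linarith
  have he : 0 < Real.exp x := Real.exp_pos x
  have hexL : Real.exp x ≤ Real.exp xL := Real.exp_le_exp.2 hx
  have heΛ : Real.exp x * Λ ≤ 2 * s₀ := by
    have : Real.exp x ≤ 2 * s₀ / Λ := hexL.trans hxL.le
    rwa [le_div_iff₀ hΛpos] at this
  have hxL0 : xL < 0 := by
    have h1 : Real.exp xL < 1 := by
      rw [hxL, div_lt_one hΛpos]; linarith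
    exact Real.exp_lt_one_iff.1 h1
  have hx0 : x ≤ 0 := by linarith
  obtain ⟨he2, hrem1, hrem2⟩ := inner_atoms_small hδΛ hδ hδ' he heΛ hs₀'
  obtain ⟨hWc, hst1, hst2⟩ := htc x (by linarith)
  obtain ⟨hw, hw', hst0, hsd⟩ := htd x hx0
  have hst1' : 7 / 10 ≤ S x * Real.exp x := by rwa [mul_comm] at hst1
  have hst2' : S x * Real.exp x ≤ 1 := by rwa [mul_comm] at hst2
  have hst0' : |S x * Real.exp x - s₀| ≤ δ ^ 2 := by rw [mul_comm]; exact hst0.trans hrem1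
  have hDd : 0 < S x ^ 2 - (1 - W x) ^ 2 := by
    -- `S ≥ 0.7/e ≥ 350`, `(1 − W)² ≤ (5/4)²`
    obtain ⟨hWl, hWu⟩ := abs_le.1 hWc
    have hS350 : 350 ≤ S x := by
      by_contra hcon; push Not at hcon
      have : S x * Real.exp x < 350 * (2 * δ) := by nlinarith
      nlinarith
    nlinarith
  refine ⟨he, he2, heΛ, hx0, hst1', hst2', hst0', hsd.trans hrem2, hw.trans hrem1, hw'.trans hrem2, hDd, ?_, ?_, ?_⟩
  · field_simp
  · positivity
  · rw [div_mul_eq_mul_div, div_le_iff₀ (by linarith)]; linarith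

/-- **THE ENVELOPE OF THE INNER `V`-SOURCE.** For a `(1 + S)`-weighted source of size `N` and `x ≤ x_Λ`:
`|h₂(x)| ≤ N(17ρ/50 + ρ²/100)`, `h₂ = −Λe^{2x}S((1 − W)f₂ + Sf₁/3)/(s₀²(S² − (1 − W)²))`, `ρ = (Λ/s₀)eˣ`. [folklore] -/
theorem inner_h2_at (hr1 : 17307 / 15625 ≤ r) (hr2 : r ≤ 697 / 625) (hδΛ : δ * Λ = 1) (hδ : 0 < δ) (hδ' : δ ≤ 1 / 1000)
    (hs₀ : 7 / 10 ≤ s₀) (hs₀' : s₀ ≤ 1) (hxL : Real.exp xL = 2 * s₀ / Λ) (hSpos : ∀ x, 0 < S x)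
    (htc : ∀ x, x ≤ 1 → |W x| ≤ 1 / 4 ∧ 7 / 10 ≤ Real.exp x * S x ∧ Real.exp x * S x ≤ 1)
    (htd : ∀ x, x ≤ 0 → |W x - (r - 1)| ≤ Real.exp x ^ 2 / 10 + 2 * Real.exp x ^ 4 ∧
      |deriv W x| ≤ Real.exp x ^ 2 / 5 + 2 * Real.exp x ^ 4 ∧ |Real.exp x * S x - s₀| ≤ Real.exp x ^ 2 / 10 + 2 * Real.exp x ^ 4 ∧
      |Real.exp x * (S x + deriv S x)| ≤ Real.exp x ^ 2 / 5 + 2 * Real.exp x ^ 4)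
    (hN : 0 ≤ N) (hf : ∀ y, |f₁ y| / (1 + S y) + |f₂ y| / S y ≤ N) {x : ℝ} (hx : x ≤ xL) :
    |-(Λ * Real.exp x ^ 2 * S x * ((1 - W x) * f₂ x + S x * f₁ x / 3)) / (s₀ ^ 2 * (S x ^ 2 - (1 - W x) ^ 2))| ≤
      N * (17 / 50 * (Λ / s₀ * Real.exp x) + (Λ / s₀ * Real.exp x) ^ 2 / 100) := by
  obtain ⟨he, he2, -, -, hst1, hst2, hst0, -, hw, -, hDd, hρ, -, -⟩ :=
    inner_atoms_at hδΛ hδ hδ' hs₀ hs₀' hxL htc htd hx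
  have hs0 : (0:ℝ) < s₀ := by linarith
  set h₂ : ℝ := -(Λ * Real.exp x ^ 2 * S x * ((1 - W x) * f₂ x + S x * f₁ x / 3)) / (s₀ ^ 2 * (S x ^ 2 - (1 - W x) ^ 2))
    with hh₂
  have hh2 : h₂ * (s₀ ^ 2 * (S x ^ 2 - (1 - W x) ^ 2)) = -(Λ * Real.exp x ^ 2 * S x * ((1 - W x) * f₂ x + S x * f₁ x / 3)) := by
    rw [hh₂]; exact div_mul_cancel₀ _ (by positivity)
  -- source bounds
  have hSx := hSpos x
  have hfx := hf x
  have hf1 : |f₁ x| ≤ N * (1 + S x) := by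
    have h1 : |f₁ x| / (1 + S x) ≤ N := by linarith [div_nonneg (abs_nonneg (f₂ x)) hSx.le]
    rwa [div_le_iff₀ (by linarith)] at h1
  have hf2 : |f₂ x| ≤ N * S x := by
    have h1 : |f₂ x| / S x ≤ N := by linarith [div_nonneg (abs_nonneg (f₁ x)) (by linarith : (0:ℝ) ≤ 1 + S x)]
    rwa [div_le_iff₀ hSx] at h1
  have hF₁ : |Real.exp x * f₁ x| ≤ N * (Real.exp x + S x * Real.exp x) := by
    rw [abs_mul, abs_of_pos he]; nlinarith
  have hF₂ : |Real.exp x * f₂ x| ≤ N * (S x * Real.exp x) := by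
    rw [abs_mul, abs_of_pos he]; nlinarith
  exact inner_h2_bound hδΛ hδ hδ' he he2 hs₀ hρ hst1 hst2 hst0 hw hr1 hr2 hN hF₁ hF₂ hh2

/-- **Registered helper `packingResolventW_innerPoint` of `stub_packingResolventW`: THE NORMAL FORM WITH ITS BOUNDS AT A
POINT OF THE INNER REGION.** For a differentiable real solution `(u₁, u₂)` of the real resolvent system at `x ≤ x_Λ` with a
`(1 + S)`-weighted source of size `N`: `V = Λe^{2x}Su₂/s₀²` has derivative `V′ = Λ(2e^{2x}Su₂ + e^{2x}S′u₂ + e^{2x}Su₂′)/s₀²`,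
and there are coefficients with `u₁′ = a₁₁u₁ + a₁₂V + h₁`, `V′ = a₂₁u₁ + a₂₂V + h₂` (`h₂` as in `inner_h2_at`),
`|a₁₁ + 3| ≤ 8δ`, `|a₁₂ − 3| ≤ δ/10`, `|a₂₁ − ρ²/3| ≤ (2/3)ρ²δ`, `0 ≤ a₂₂ ≤ (9/10)ρ²δ`, `|h₁| ≤ (301/100)N`. [folklore] -/
theorem packingResolventW_innerPoint : ∀ (r Λ δ s₀ N xL : ℝ) (W S u₁ u₂ f₁ f₂ : ℝ → ℝ), 17307 / 15625 ≤ r → r ≤ 697 / 625 → δ * Λ = 1 → 0 < δ → δ ≤ 1 / 1000 → 7 / 10 ≤ s₀ → s₀ ≤ 1 → Real.exp xL = 2 * s₀ / Λ → (∀ x, 0 < S x) → Differentiable ℝ S → Differentiable ℝ u₂ → (∀ x, x ≤ 1 → |W x| ≤ 1 / 4 ∧ 7 / 10 ≤ Real.exp x * S x ∧ Real.exp x * S x ≤ 1) → (∀ x, x ≤ 0 → |W x - (r - 1)| ≤ Real.exp x ^ 2 / 10 + 2 * Real.exp x ^ 4 ∧ |deriv W x| ≤ Real.exp x ^ 2 /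 5 + 2 * Real.exp x ^ 4 ∧ |Real.exp x * S x - s₀| ≤ Real.exp x ^ 2 / 10 + 2 * Real.exp x ^ 4 ∧ |Real.exp x * (S x + deriv S x)| ≤ Real.exp x ^ 2 / 5 + 2 * Real.exp x ^ 4) → 0 ≤ N → (∀ y, |f₁ y| / (1 + S y) + |f₂ y| / S y ≤ N) → ∀ x, x ≤ xL → (Λ * u₁ x - ((W x - 1) * deriv u₁ x + 3 * S x * deriv u₂ x + (deriv W x + 2 * W x - r) * u₁ x + (3 * deriv S x + 6 * S x) * u₂ x) = f₁ x ∧ Λ * u₂ x - (S x / 3 * deriv u₁ x + (W x - 1) * deriv u₂ x + (deriv S x + 2 * S x) * u₁ x + (deriv W x / 3 + 2 * W x - r) * u₂ x) = f₂ x) → HasDerivAt (fun y => Λ * Real.exp y ^ 2 * S y * u₂ y / s₀ ^ 2) (Λ * (2 * Real.exp x ^ 2 * S x * u₂ x + Real.exp x ^ 2 * deriv S x * u₂ x + Real.exp x ^ 2 * S x * deriv u₂ x) / s₀ ^ 2) x ∧ ∃ a₁₁ a₁₂ a₂₁ a₂₂ h₁ : ℝ, deriv u₁ x = a₁₁ *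 u₁ x + a₁₂ * (Λ * Real.exp x ^ 2 * S x * u₂ x / s₀ ^ 2) + h₁ ∧ Λ * (2 * Real.exp x ^ 2 * S x * u₂ x + Real.exp x ^ 2 * deriv S x * u₂ x + Real.exp x ^ 2 * S x * deriv u₂ x) / s₀ ^ 2 = a₂₁ * u₁ x + a₂₂ * (Λ * Real.exp x ^ 2 * S x * u₂ x / s₀ ^ 2) + -(Λ * Real.exp x ^ 2 * S x * ((1 - W x) * f₂ x + S x * f₁ x / 3)) / (s₀ ^ 2 * (S x ^ 2 - (1 - W x) ^ 2)) ∧ |a₁₁ + 3| ≤ 8 * δ ∧ |a₁₂ - 3| ≤ δ / 10 ∧ |a₂₁ - (Λ / s₀ * Real.exp x) ^ 2 / 3| ≤ 2 / 3 * (Λ / s₀ * Real.exp x) ^ 2 * δ ∧ 0 ≤ a₂₂ ∧ a₂₂ ≤ 9 / 10 * (Λ / s₀ * Real.exp x) ^ 2 * δ ∧ |h₁| ≤ 301 / 100 * N := by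
  intro r Λ δ s₀ N xL W S u₁ u₂ f₁ f₂ hr1 hr2 hδΛ hδ hδ' hs₀ hs₀' hxL hSpos hSd hu₂ htc htd hN hf x hx heq
  obtain ⟨he, he2, -, -, hst1, hst2, hst0, hsd, hw, hw', hDd, hρ, hρ0, hρ2⟩ :=
    inner_atoms_at hδΛ hδ hδ' hs₀ hs₀' hxL htc htd hx
  have hs0 : (0:ℝ) < s₀ := by linarith
  have hΛ : 1000 ≤ Λ := thousand_le_of_delta hδΛ hδ hδ'
  have hSx := hSpos x
  -- the derivative of `V`
  have hVd : HasDerivAt (fun y => Λ * Real.exp y ^ 2 * S y * u₂ y / s₀ ^ 2)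
      (Λ * (2 * Real.exp x ^ 2 * S x * u₂ x + Real.exp x ^ 2 * deriv S x * u₂ x + Real.exp x ^ 2 * S x * deriv u₂ x) / s₀ ^ 2) x := by
    have h1 : HasDerivAt (fun y => Real.exp y ^ 2) (2 * Real.exp x * Real.exp x) x := by
      simpa using (Real.hasDerivAt_exp x).fun_pow 2
    have h2 := (((h1.const_mul Λ).mul (hSd x).hasDerivAt).mul (hu₂ x).hasDerivAt).div_const (s₀ ^ 2)
    refine h2.congr_deriv ?_
    simp only [Pi.mul_apply]
    ring
  refine ⟨hVd, ?_⟩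
  -- source bounds
  have hfx := hf x
  have hf1 : |f₁ x| ≤ N * (1 + S x) := by
    have h1 : |f₁ x| / (1 + S x) ≤ N := by linarith [div_nonneg (abs_nonneg (f₂ x)) hSx.le]
    rwa [div_le_iff₀ (by linarith)] at h1
  have hf2 : |f₂ x| ≤ N * S x := by
    have h1 : |f₂ x| / S x ≤ N := by linarith [div_nonneg (abs_nonneg (f₁ x)) (by linarith : (0:ℝ) ≤ 1 + S x)]
    rwa [div_le_iff₀ hSx] at h1
  have hF₁ : |Real.exp x * f₁ x| ≤ N * (Real.exp x + S x * Real.exp x) := by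
    rw [abs_mul, abs_of_pos he]; nlinarith
  have hF₂ : |Real.exp x * f₂ x| ≤ N * (S x * Real.exp x) := by
    rw [abs_mul, abs_of_pos he]; nlinarith
  -- the coefficients (plain variables with their defining equations)
  have hDd0 : (S x ^ 2 - (1 - W x) ^ 2) ≠ 0 := hDd.ne'
  have hK2 : Λ * Real.exp x ^ 2 * S x * (S x ^ 2 - (1 - W x) ^ 2) ≠ 0 := by positivity
  have hK3 : s₀ ^ 2 * (S x ^ 2 - (1 - W x) ^ 2) ≠ 0 := by positivity
  have hK4 : (S x ^ 2 - (1 - W x) ^ 2) * S x ≠ 0 := by positivity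
  obtain ⟨a₁₁, ha₁₁⟩ : ∃ a : ℝ, a = (-3 * (2 * S x + deriv S x) * S x + (1 - W x) * (Λ - (deriv W x + 2 * W x - r))) / (S x ^ 2 - (1 - W x) ^ 2) :=
    ⟨_, rfl⟩
  obtain ⟨a₁₂, ha₁₂⟩ : ∃ a : ℝ, a = 3 * s₀ ^ 2 * (Λ * S x + (W x - 1) * (2 * S x + deriv S x) - (deriv W x / 3 + 2 * W x - r) * S x) /
    (Λ * Real.exp x ^ 2 * S x * (S x ^ 2 - (1 - W x) ^ 2)) := ⟨_, rfl⟩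
  obtain ⟨a₂₁, ha₂₁⟩ : ∃ a : ℝ, a = Λ * Real.exp x ^ 2 * S x * (Λ * S x / 3 - (deriv W x + 2 * W x - r) * S x / 3 -
    (1 - W x) * (2 * S x + deriv S x)) / (s₀ ^ 2 * (S x ^ 2 - (1 - W x) ^ 2)) := ⟨_, rfl⟩
  obtain ⟨a₂₂, ha₂₂⟩ : ∃ a : ℝ, a = (1 - W x) * (Λ * S x + (W x - 1) * (2 * S x + deriv S x) - (deriv W x / 3 + 2 * W x - r) * S x) /
    ((S x ^ 2 - (1 - W x) ^ 2) * S x) := ⟨_, rfl⟩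
  obtain ⟨h₁, hh₁⟩ : ∃ a : ℝ, a = -(3 * S x * f₂ x + (1 - W x) * f₁ x) / (S x ^ 2 - (1 - W x) ^ 2) := ⟨_, rfl⟩
  have ca11 : a₁₁ * (S x ^ 2 - (1 - W x) ^ 2) = -3 * (2 * S x + deriv S x) * S x + (1 - W x) * (Λ - (deriv W x + 2 * W x - r)) := by
    rw [ha₁₁]; exact div_mul_cancel₀ _ hDd0
  have ca12 : a₁₂ * (Λ * Real.exp x ^ 2 * S x * (S x ^ 2 - (1 - W x) ^ 2)) =
      3 * s₀ ^ 2 * (Λ * S x + (W x - 1) * (2 * S x + deriv S x) - (deriv W x / 3 + 2 * W x - r) * S x) := by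
    rw [ha₁₂]; exact div_mul_cancel₀ _ hK2
  have ca21 : a₂₁ * (s₀ ^ 2 * (S x ^ 2 - (1 - W x) ^ 2)) = Λ * Real.exp x ^ 2 * S x * (Λ * S x / 3 - (deriv W x + 2 * W x - r) * S x / 3 -
      (1 - W x) * (2 * S x + deriv S x)) := by
    rw [ha₂₁]; exact div_mul_cancel₀ _ hK3
  have ca22 : a₂₂ * ((S x ^ 2 - (1 - W x) ^ 2) * S x) = (1 - W x) * (Λ * S x + (W x - 1) * (2 * S x + deriv S x) -
      (deriv W x / 3 + 2 * W x - r) * S x) := by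
    rw [ha₂₂]; exact div_mul_cancel₀ _ hK4
  have ch1 : h₁ * (S x ^ 2 - (1 - W x) ^ 2) = -(3 * S x * f₂ x + (1 - W x) * f₁ x) := by
    rw [hh₁]; exact div_mul_cancel₀ _ hDd0
  have ch2 : -(Λ * Real.exp x ^ 2 * S x * ((1 - W x) * f₂ x + S x * f₁ x / 3)) / (s₀ ^ 2 * (S x ^ 2 - (1 - W x) ^ 2)) * (s₀ ^ 2 * (S x ^ 2 - (1 - W x) ^ 2)) =
      -(Λ * Real.exp x ^ 2 * S x * ((1 - W x) * f₂ x + S x * f₁ x / 3)) := div_mul_cancel₀ _ hK3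
  -- the normal form
  have hV : s₀ ^ 2 * (Λ * Real.exp x ^ 2 * S x * u₂ x / s₀ ^ 2) = Λ * Real.exp x ^ 2 * S x * u₂ x := by
    field_simp
  have hV' : s₀ ^ 2 * (Λ * (2 * Real.exp x ^ 2 * S x * u₂ x + Real.exp x ^ 2 * deriv S x * u₂ x +
      Real.exp x ^ 2 * S x * deriv u₂ x) / s₀ ^ 2) = Λ * (2 * Real.exp x ^ 2 * S x * u₂ x + Real.exp x ^ 2 * deriv S x * u₂ x +
      Real.exp x ^ 2 * S x * deriv u₂ x) := by field_simp
  obtain ⟨hnf1, hnf2⟩ := inner_normal_form Λ r (W x) (deriv W x) (S x) (deriv S x) (u₁ x) (deriv u₁ x) (u₂ x) (deriv u₂ x)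
    (f₁ x) (f₂ x) (Real.exp x) s₀ _ _ a₁₁ a₁₂ a₂₁ a₂₂ h₁ _ hSx.ne' hDd0 hs0.ne' heq.1 heq.2 hV hV' ca11 ca12 ca21 ca22 ch1 ch2
  -- the bounds
  obtain ⟨b11, b12, b21, b22a, b22b⟩ := packingResolventW_innerCoeff Λ δ r (W x) (deriv W x) (S x) (deriv S x) (Real.exp x)
    s₀ (Λ / s₀ * Real.exp x) a₁₁ a₁₂ a₂₁ a₂₂ hδΛ hδ hδ' he he2 hs₀ hs₀' hρ hst1 hst2 hst0 hsd hw hw' hr1 hr2 ca11 ca12 ca21 ca22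
  have bh1 := inner_h1_bound hδ hδ' he he2 hst1 hst2 hw hr1 hr2 hN hF₁ hF₂ ch1
  exact ⟨a₁₁, a₁₂, a₂₁, a₂₂, h₁, hnf1, hnf2, b11, b12, b21, b22a, b22b, bh1⟩

end Inner

end Summit.AtomisticToContinuum.HydrodynamicLimit.Theorems.PackingAnalyticImplosion

end
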